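import Summits.RiemannHypothesis.RiemannHypothesis.Theorems.PfPersistenceEigenspaceReaders
import HarnessLib

/-!
# PF persistence — NO MARGIN: a continuous scale-free eigenvector reader separates `ζ` from the negatives by no
margin, with NO binder and NO hypothesis on `ζ`'s reading (pub-rhpf, barrier-prover gen 4; file 4 of the
binder-free eigenvector wall)

**HONEST FRAMING. This is a long-odds MECHANISM SEARCH; no RH claims.** RH-free; every statement PROVED; no DATA.
The only non-theorem inputs are ORDINARY HYPOTHESES ON THE READER (continuity at `ζ`'s bottom eigenvectors at the
window(s), invariance under nonzero (componentwise) rescaling) — hypotheses, never asserted; NOTHING is assumed about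
`ζ`'s reading, its bottom eigenvalue's simplicity, or a gap. Nothing here bears on the truth of RH.

* §1 UNIFORM MARGIN NEAR A SUBSPACE (`exists_tau_margin_of_nearSpace`): `E` a closed submodule of `Fin n → ℝ`, `Φ`
  scale-free and continuous at every nonzero point of `E`, `η > 0` ⇒ for some `τ > 0`, every `u ≠ 0` in the
  `NearSpace τ`-cone of `E` has `|Φ u − Φ e| < η` for some nonzero `e ∈ E` (compact annulus + thickening, as in
  `PfPersistenceEigenspaceReaders`); the PRODUCT form for joint readers (`exists_tau_tuple_margin_of_nearSpace`).
* §2 THE NO-MARGIN WALLS: for every `η > 0` the MARGIN CLASS `{d | every bottom vector u of d at win has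
  |Φ u − Φ e| < η for some bottom vector e of ζ at win}` is robust at `ζ` within the dial space and separates `ζ`
  from the negatives of no `D ⊇ arithDialSpace` (`not_separates_of_spaceReader_margin_subset`); the joint-reader
  form at finitely many windows (`not_separates_of_tupleSpaceReader_margin_subset`). In words: whatever a continuous
  scale-free functional of the bottom eigenvector(s) reads on `ζ`, detectably negative ARITHMETIC data read the
  same up to any prescribed `η` — the gen-3 margin wall (`not_separates_of_reader_margin_subset`, binder
  `HasBottomGap`) with the binder and the simplicity assumption removed.
HONEST RESIDUE (= gap class G1 / door E1, recorded not targeted): `η = 0` (exact readings), readers discontinuous at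
`ζ`'s eigenvectors or not scale-free, and `∀`-window / sliding-window readers (no uniform `τ`).
-/

set_option linter.dupNamespace false  -- the mandated namespace repeats `RiemannHypothesis`

noncomputable section

open Real Finset Matrix Set

namespace Summit.RiemannHypothesis.RiemannHypothesis.Theorems.PfPersistence

/-! ## §1 Uniform margin near a closed subspace -/

/-- **PROVED — UNIFORM MARGIN NEAR A CLOSED SUBSPACE.** `E` closed, `Φ` scale-free and continuous at every nonzero
point of `E`, `η > 0` ⇒ ∃ `τ > 0`, every `u ≠ 0` with `NearSpace τ u E` satisfies `|Φ u − Φ e| < η` for some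
nonzero `e ∈ E`. [folklore] -/
theorem exists_tau_margin_of_nearSpace {n : ℕ} (E : Submodule ℝ (Fin n → ℝ)) (hE : IsClosed (E : Set (Fin n → ℝ)))
    {Φ : (Fin n → ℝ) → ℝ} (hΦ : ∀ e ∈ E, e ≠ 0 → ContinuousAt Φ e)
    (hscale : ∀ t : ℝ, t ≠ 0 → ∀ u : Fin n → ℝ, Φ (t • u) = Φ u) {η : ℝ} (hη : 0 < η) :
    ∃ τ : ℝ, 0 < τ ∧ ∀ u : Fin n → ℝ, u ≠ 0 → NearSpace τ u E → ∃ e ∈ E, e ≠ 0 ∧ |Φ u - Φ e| < η := by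
  set C : Set (Fin n → ℝ) := (E : Set (Fin n → ℝ)) ∩ {e | 1 / 4 ≤ e ⬝ᵥ e ∧ e ⬝ᵥ e ≤ 4} with hC
  have hcont : Continuous fun e : Fin n → ℝ => e ⬝ᵥ e := continuous_id.dotProduct continuous_id
  have hCc : IsCompact C :=
    (isCompact_closedBall (0 : Fin n → ℝ) 2).of_isClosed_subset
      (hE.inter ((isClosed_le continuous_const hcont).inter (isClosed_le hcont continuous_const)))
      fun e he => mem_closedBall_two_of_dotSelf_le he.2.2
  have hCmem : ∀ p ∈ C, p ∈ E ∧ p ≠ 0 := by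
    rintro p ⟨hpE, hp1, -⟩
    refine ⟨hpE, fun h0 => ?_⟩
    rw [h0] at hp1
    simp only [dotProduct_zero] at hp1
    linarith
  have hballs : ∀ p : Fin n → ℝ, ∃ δ : ℝ, 0 < δ ∧ (p ∈ C → ∀ y : Fin n → ℝ, dist y p < δ → |Φ y - Φ p| < η) := by
    intro p
    by_cases hp : p ∈ C
    · obtain ⟨hpE, hp0⟩ := hCmem p hp
      obtain ⟨δ, hδ, hball⟩ := Metric.continuousAt_iff.1 (hΦ p hpE hp0) η hη
      exact ⟨δ, hδ, fun _ y hy => by have h := hball hy; rwa [Real.dist_eq] at h⟩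
    · exact ⟨1, one_pos, fun h => absurd h hp⟩
  choose δ hδ hδΦ using hballs
  have hT : IsOpen (⋃ p ∈ C, Metric.ball p (δ p)) := isOpen_biUnion fun _ _ => Metric.isOpen_ball
  have hCT : C ⊆ ⋃ p ∈ C, Metric.ball p (δ p) := fun p hp => mem_iUnion₂.2 ⟨p, hp, Metric.mem_ball_self (hδ p)⟩
  obtain ⟨ρ, hρ, hthick⟩ := hCc.exists_thickening_subset_open hT hCT
  refine ⟨min (1 / 16) (ρ ^ 2 / 2), lt_min (by norm_num) (by positivity), fun u hu hnear => ?_⟩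
  set τ := min (1 / 16) (ρ ^ 2 / 2) with hτ_def
  have hτ16 : τ ≤ 1 / 16 := min_le_left _ _
  have hτρ : τ < ρ ^ 2 := lt_of_le_of_lt (min_le_right _ _) (by nlinarith [hρ])
  have hunit : ∀ v : Fin n → ℝ, v ⬝ᵥ v = 1 → NearSpace τ v E → ∃ e ∈ E, e ≠ 0 ∧ |Φ v - Φ e| < η := by
    intro v hv1 hv
    obtain ⟨e, he, hwe⟩ := hv
    rw [hv1, mul_one] at hwe
    have heC : e ∈ C := ⟨he, dotSelf_mem_annulus_of_near_unit hv1 (hwe.trans hτ16)⟩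
    have hdist : dist v e < ρ := by
      rw [dist_eq_norm]
      exact norm_lt_of_dotSelf_lt_sq hρ (lt_of_le_of_lt hwe hτρ)
    obtain ⟨p, hp, hvp⟩ := mem_iUnion₂.1 (hthick (Metric.mem_thickening_iff.2 ⟨e, heC, hdist⟩))
    exact ⟨p, (hCmem p hp).1, (hCmem p hp).2, hδΦ p hp v (Metric.mem_ball.1 hvp)⟩
  have hne : (Real.sqrt (u ⬝ᵥ u))⁻¹ ≠ 0 := inv_ne_zero (Real.sqrt_pos.2 (dotSelf_pos_of_ne_zero hu)).ne'
  obtain ⟨e, he, he0, h⟩ := hunit _ (dotSelf_sqrt_inv_smul hu) (hnear.smul_left _)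
  exact ⟨e, he, he0, by rwa [hscale _ hne u] at h⟩

/-- **PROVED — UNIFORM MARGIN NEAR A PRODUCT OF CLOSED SUBSPACES** (joint readers; componentwise scale-freeness;
product of annuli, sup metric). [folklore] -/
theorem exists_tau_tuple_margin_of_nearSpace {k : ℕ} {m : Fin k → ℕ}
    (E : (i : Fin k) → Submodule ℝ (Fin (m i) → ℝ)) (hE : ∀ i, IsClosed (E i : Set (Fin (m i) → ℝ)))
    {Φ : ((i : Fin k) → (Fin (m i) → ℝ)) → ℝ}
    (hΦ : ∀ U : (i : Fin k) → (Fin (m i) → ℝ), (∀ i, U i ∈ E i ∧ U i ≠ 0) → ContinuousAt Φ U)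
    (hscale : ∀ t : Fin k → ℝ, (∀ i, t i ≠ 0) → ∀ U : (i : Fin k) → (Fin (m i) → ℝ), Φ (fun i => t i • U i) = Φ U)
    {η : ℝ} (hη : 0 < η) :
    ∃ τ : ℝ, 0 < τ ∧ ∀ U : (i : Fin k) → (Fin (m i) → ℝ), (∀ i, U i ≠ 0 ∧ NearSpace τ (U i) (E i)) →
      ∃ P : (i : Fin k) → (Fin (m i) → ℝ), (∀ i, P i ∈ E i ∧ P i ≠ 0) ∧ |Φ U - Φ P| < η := by
  set C : Set ((i : Fin k) → (Fin (m i) → ℝ)) :=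
    Set.pi Set.univ fun i => (E i : Set (Fin (m i) → ℝ)) ∩ {e | 1 / 4 ≤ e ⬝ᵥ e ∧ e ⬝ᵥ e ≤ 4} with hC
  have hCc : IsCompact C := by
    refine isCompact_univ_pi fun i => ?_
    have hcont : Continuous fun e : Fin (m i) → ℝ => e ⬝ᵥ e := continuous_id.dotProduct continuous_id
    exact (isCompact_closedBall (0 : Fin (m i) → ℝ) 2).of_isClosed_subset
      ((hE i).inter ((isClosed_le continuous_const hcont).inter (isClosed_le hcont continuous_const)))
      fun e he => mem_closedBall_two_of_dotSelf_le he.2.2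
  have hCmem : ∀ p ∈ C, ∀ i, p i ∈ E i ∧ p i ≠ 0 := by
    intro p hp i
    obtain ⟨hpE, hp1, -⟩ := Set.mem_univ_pi.1 hp i
    refine ⟨hpE, fun h0 => ?_⟩
    rw [h0] at hp1
    simp only [dotProduct_zero] at hp1
    linarith
  have hballs : ∀ p : (i : Fin k) → (Fin (m i) → ℝ), ∃ δ : ℝ, 0 < δ ∧
      (p ∈ C → ∀ y : (i : Fin k) → (Fin (m i) → ℝ), dist y p < δ → |Φ y - Φ p| < η) := by
    intro p
    by_cases hp : p ∈ C
    · obtain ⟨δ, hδ, hball⟩ := Metric.continuousAt_iff.1 (hΦ p (hCmem p hp)) η hη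
      exact ⟨δ, hδ, fun _ y hy => by have h := hball hy; rwa [Real.dist_eq] at h⟩
    · exact ⟨1, one_pos, fun h => absurd h hp⟩
  choose δ hδ hδΦ using hballs
  have hT : IsOpen (⋃ p ∈ C, Metric.ball p (δ p)) := isOpen_biUnion fun _ _ => Metric.isOpen_ball
  have hCT : C ⊆ ⋃ p ∈ C, Metric.ball p (δ p) := fun p hp => mem_iUnion₂.2 ⟨p, hp, Metric.mem_ball_self (hδ p)⟩
  obtain ⟨ρ, hρ, hthick⟩ := hCc.exists_thickening_subset_open hT hCT
  refine ⟨min (1 / 16) (ρ ^ 2 / 2), lt_min (by norm_num) (by positivity), fun U hU => ?_⟩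
  set τ := min (1 / 16) (ρ ^ 2 / 2) with hτ_def
  have hτ16 : τ ≤ 1 / 16 := min_le_left _ _
  have hτρ : τ < ρ ^ 2 := lt_of_le_of_lt (min_le_right _ _) (by nlinarith [hρ])
  have hunit : ∀ V : (i : Fin k) → (Fin (m i) → ℝ), (∀ i, V i ⬝ᵥ V i = 1) →
      (∀ i, NearSpace τ (V i) (E i)) →
      ∃ P : (i : Fin k) → (Fin (m i) → ℝ), (∀ i, P i ∈ E i ∧ P i ≠ 0) ∧ |Φ V - Φ P| < η := by
    intro V hV1 hV
    choose e he hwe using hV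
    have heC : e ∈ C := Set.mem_univ_pi.2 fun i =>
      ⟨he i, dotSelf_mem_annulus_of_near_unit (hV1 i) (by have := hwe i; rw [hV1 i, mul_one] at this; linarith)⟩
    have hdist : dist V e < ρ := by
      rw [dist_pi_lt_iff hρ]
      intro i
      rw [dist_eq_norm]
      refine norm_lt_of_dotSelf_lt_sq hρ (lt_of_le_of_lt ?_ hτρ)
      have := hwe i
      rwa [hV1 i, mul_one] at this
    obtain ⟨p, hp, hVp⟩ := mem_iUnion₂.1 (hthick (Metric.mem_thickening_iff.2 ⟨e, heC, hdist⟩))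
    exact ⟨p, hCmem p hp, hδΦ p hp V (Metric.mem_ball.1 hVp)⟩
  have hne : ∀ i, (Real.sqrt (U i ⬝ᵥ U i))⁻¹ ≠ 0 := fun i =>
    inv_ne_zero (Real.sqrt_pos.2 (dotSelf_pos_of_ne_zero (hU i).1)).ne'
  obtain ⟨P, hP, h⟩ := hunit (fun i => (Real.sqrt (U i ⬝ᵥ U i))⁻¹ • U i)
    (fun i => dotSelf_sqrt_inv_smul (hU i).1) (fun i => (hU i).2.smul_left _)
  exact ⟨P, hP, by rwa [hscale _ hne U] at h⟩

/-! ## §2 The no-margin walls -/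

/-- **PROVED — ROBUSTNESS OF THE MARGIN CLASS, NO BINDER, NO HYPOTHESIS ON `ζ`'S READING.** `Φ` scale-free and
continuous at every bottom vector of `ζ` at `win`, `η > 0`: the class of data every bottom vector of which at `win`
reads within `η` of SOME bottom vector of `ζ` at `win` is robust at `ζ` within the dial space. [folklore] -/
theorem robustWithin_dialSpace_spaceReader_margin (win : Window) {Φ : (Fin (win.N + 1) → ℝ) → ℝ}
    (hΦ : ∀ u, IsBottomVector (zetaDatum win) u → ContinuousAt Φ u)
    (hscale : ∀ t : ℝ, t ≠ 0 → ∀ u : Fin (win.N + 1) → ℝ, Φ (t • u) = Φ u) {η : ℝ} (hη : 0 < η) :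
    RobustWithin dialSpace
      {d | ∀ u, IsBottomVector (d win) u → ∃ e, IsBottomVector (zetaDatum win) e ∧ |Φ u - Φ e| < η} zetaDatum := by
  obtain ⟨τ, hτ, hcone⟩ := exists_tau_margin_of_nearSpace (bottomSpace (zetaDatum win)) (isClosed_bottomSpace _)
    (fun e he h0 => hΦ e ⟨h0, he⟩) hscale hη
  refine (robustWithin_dialSpace_esToleranceClass_zeta (fun _ : Fin 1 => win) hτ).mono ?_
  rintro d ⟨hd, -⟩ u hu
  obtain ⟨e, he, he0, h⟩ := hcone u hu.1 ((hd 0).2 u hu)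
  exact ⟨e, ⟨he0, he⟩, h⟩

/-- **PROVED — THE NO-MARGIN WALL.** For every `η > 0`, a scale-free reader of the bottom vector at ONE window,
continuous at `ζ`'s bottom eigenvectors there, separates `ζ` from the negatives of no `D ⊇ arithDialSpace` by the
margin `η`: the margin class (restricted to the arithmetic dial space) is not a separating class (dichotomy-carried,
otherwise UNCONDITIONAL; no binder, no simplicity, nothing assumed about `ζ`'s reading). [folklore] -/
theorem not_separates_of_spaceReader_margin_subset (win : Window) {Φ : (Fin (win.N + 1) → ℝ) → ℝ}
    (hΦ : ∀ u, IsBottomVector (zetaDatum win) u → ContinuousAt Φ u)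
    (hscale : ∀ t : ℝ, t ≠ 0 → ∀ u : Fin (win.N + 1) → ℝ, Φ (t • u) = Φ u) {η : ℝ} (hη : 0 < η)
    {S D : Set Datum}
    (hS : {d | ∀ u, IsBottomVector (d win) u → ∃ e, IsBottomVector (zetaDatum win) e ∧ |Φ u - Φ e| < η} ∩
      arithDialSpace ⊆ S) (hD : arithDialSpace ⊆ D) : ¬ Separates S D zetaDatum :=
  not_separates_of_robustWithin_arith hD
    (((robustWithin_dialSpace_spaceReader_margin win hΦ hscale hη).anti arithDialSpace_subset_dialSpace).mono hS)

/-- **PROVED — the existential form** (`∃ u bottom of d win` reading within `η` of some bottom vector of `ζ`).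
[folklore] -/
theorem not_separates_of_exists_spaceReader_margin_subset (win : Window) {Φ : (Fin (win.N + 1) → ℝ) → ℝ}
    (hΦ : ∀ u, IsBottomVector (zetaDatum win) u → ContinuousAt Φ u)
    (hscale : ∀ t : ℝ, t ≠ 0 → ∀ u : Fin (win.N + 1) → ℝ, Φ (t • u) = Φ u) {η : ℝ} (hη : 0 < η)
    {S D : Set Datum}
    (hS : {d | ∃ u, IsBottomVector (d win) u ∧ ∃ e, IsBottomVector (zetaDatum win) e ∧ |Φ u - Φ e| < η} ∩
      arithDialSpace ⊆ S) (hD : arithDialSpace ⊆ D) : ¬ Separates S D zetaDatum := by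
  refine not_separates_of_robustWithin_arith hD
    (((robustWithin_dialSpace_spaceReader_margin win hΦ hscale hη).anti arithDialSpace_subset_dialSpace).mono ?_)
  rintro d ⟨hd, hda⟩
  obtain ⟨u, hu, -⟩ := exists_isBottomVector_of_mem_dialSpace (arithDialSpace_subset_dialSpace hda) win
  exact hS ⟨⟨u, hu, hd u hu⟩, hda⟩

/-- **PROVED — AT A SIMPLE WINDOW the margin class is the gen-3 one**: if every bottom vector of `ζ` at `win` is a
multiple of `u₀`, "within `η` of some bottom vector of `ζ`" is "within `η` of `Φ u₀`". [folklore] -/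
theorem spaceReader_margin_iff_of_simple (win : Window) {Φ : (Fin (win.N + 1) → ℝ) → ℝ}
    (hscale : ∀ t : ℝ, t ≠ 0 → ∀ u : Fin (win.N + 1) → ℝ, Φ (t • u) = Φ u) {u₀ : Fin (win.N + 1) → ℝ}
    (hu₀ : IsBottomVector (zetaDatum win) u₀) (hsimple : ∀ u, IsBottomVector (zetaDatum win) u → ∃ c : ℝ, u = c • u₀)
    (η : ℝ) (u : Fin (win.N + 1) → ℝ) :
    (∃ e, IsBottomVector (zetaDatum win) e ∧ |Φ u - Φ e| < η) ↔ |Φ u - Φ u₀| < η := by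
  constructor
  · rintro ⟨e, he, h⟩
    obtain ⟨c, rfl⟩ := hsimple e he
    have hc : c ≠ 0 := by
      rintro rfl
      exact he.1 (zero_smul _ _)
    rwa [hscale c hc u₀] at h
  · exact fun h => ⟨u₀, hu₀, h⟩

/-- **PROVED — ROBUSTNESS OF THE JOINT MARGIN CLASS AT FINITELY MANY WINDOWS, NO BINDERS.** [folklore] -/
theorem robustWithin_dialSpace_tupleSpaceReader_margin {k : ℕ} (W : Fin k → Window)
    {Φ : ((i : Fin k) → (Fin ((W i).N + 1) → ℝ)) → ℝ}
    (hΦ : ∀ U : (i : Fin k) → (Fin ((W i).N + 1) → ℝ), (∀ i, IsBottomVector (zetaDatum (W i)) (U i)) →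
      ContinuousAt Φ U)
    (hscale : ∀ t : Fin k → ℝ, (∀ i, t i ≠ 0) →
      ∀ U : (i : Fin k) → (Fin ((W i).N + 1) → ℝ), Φ (fun i => t i • U i) = Φ U)
    {η : ℝ} (hη : 0 < η) :
    RobustWithin dialSpace {d | ∀ U : (i : Fin k) → (Fin ((W i).N + 1) → ℝ),
      (∀ i, IsBottomVector (d (W i)) (U i)) → ∃ P : (i : Fin k) → (Fin ((W i).N + 1) → ℝ),
        (∀ i, IsBottomVector (zetaDatum (W i)) (P i)) ∧ |Φ U - Φ P| < η} zetaDatum := by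
  obtain ⟨τ, hτ, hcone⟩ := exists_tau_tuple_margin_of_nearSpace (m := fun i => (W i).N + 1)
    (fun i => bottomSpace (zetaDatum (W i))) (fun i => isClosed_bottomSpace _)
    (fun U hU => hΦ U fun i => ⟨(hU i).2, (hU i).1⟩) hscale hη
  refine (robustWithin_dialSpace_esToleranceClass_zeta W hτ).mono ?_
  rintro d ⟨hd, -⟩ U hU
  obtain ⟨P, hP, h⟩ := hcone U fun i => ⟨(hU i).1, (hd i).2 (U i) (hU i)⟩
  exact ⟨P, fun i => ⟨(hP i).2, (hP i).1⟩, h⟩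

/-- **PROVED — THE JOINT NO-MARGIN WALL AT FINITELY MANY WINDOWS** (`L_k × R0` transport / direction readers; no
binders, no simplicity, nothing assumed about `ζ`'s reading). [folklore] -/
theorem not_separates_of_tupleSpaceReader_margin_subset {k : ℕ} (W : Fin k → Window)
    {Φ : ((i : Fin k) → (Fin ((W i).N + 1) → ℝ)) → ℝ}
    (hΦ : ∀ U : (i : Fin k) → (Fin ((W i).N + 1) → ℝ), (∀ i, IsBottomVector (zetaDatum (W i)) (U i)) →
      ContinuousAt Φ U)
    (hscale : ∀ t : Fin k → ℝ, (∀ i, t i ≠ 0) →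
      ∀ U : (i : Fin k) → (Fin ((W i).N + 1) → ℝ), Φ (fun i => t i • U i) = Φ U)
    {η : ℝ} (hη : 0 < η) {S D : Set Datum}
    (hS : {d | ∀ U : (i : Fin k) → (Fin ((W i).N + 1) → ℝ), (∀ i, IsBottomVector (d (W i)) (U i)) →
      ∃ P : (i : Fin k) → (Fin ((W i).N + 1) → ℝ), (∀ i, IsBottomVector (zetaDatum (W i)) (P i)) ∧ |Φ U - Φ P| < η} ∩
      arithDialSpace ⊆ S) (hD : arithDialSpace ⊆ D) : ¬ Separates S D zetaDatum :=
  not_separates_of_robustWithin_arith hD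
    (((robustWithin_dialSpace_tupleSpaceReader_margin W hΦ hscale hη).anti arithDialSpace_subset_dialSpace).mono hS)

end Summit.RiemannHypothesis.RiemannHypothesis.Theorems.PfPersistence

end
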